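import Mathlib
import HarnessLib
import Summits.NavierStokesRegularity.FluidComputer.TriggeredTransferViscosityRobust
import Summits.NavierStokesRegularity.FluidComputer.TriggeredTransferJunction

/-!
# Door N1-FC split: a triggered transfer = AMPLIFIER (forced, Re-dependent) + VALVE (unforced, Re-uniform), and its glue

Cell `ns-blowup`, seat `ns-blowup-fc-prover-1` g4 (D-0074 GROUP C «bridge support»; LADDER-NS rung N1-FC).
LABEL: E–C typing + kernel bookkeeping. WHAT THIS IS NOT: not Navier–Stokes evidence — three OPEN
predicates over the door TYPE `TriggerScheme` (`TriggeredTransfer.lean`) and implications between them;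
no scheme, no kicked alphabet, no transfer and no blow-up is asserted anywhere; MODEL words (the DNS
cells PREREG-FC-TRIG-1 and -2 of `pub-fluidc`) never enter.

The typing is the planner's (`ns-blowup-fc-route` g1, package `plan/route-draft-FC/asdrafted-triggered-v1/`,
`Sketch_alpha.lean`, 2026-08-26): Tao's gate (J. Amer. Math. Soc. 29 (2016) §1.3: a logic gate of the
fluid computer = an AMPLIFIER followed by a PUMP) decomposes one triggered transfer `TriggerScheme.Step`
into

* an **amplifier** (`TriggerScheme.Amplifies 𝒮 𝒦 ν`, the ONLY half in which the Reynolds number enters):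
  every admissible seed `ε` (`ν |log ε| ≤ a U`) planted on a member `w ∈ F U` is driven by the FORCED
  flow, within the logarithmic time `T₁ ≤ (C_τ/2) (1 + |log ε|)^q / U`, to a KICKED state `u T₁ ∈ K U`
  (a new posited interface `TriggerScheme.KickAlphabet`: Clay data with the level's speed floor), the
  trigger being switched off from `T₁` on; and
* a **valve** (`TriggerScheme.Valve 𝒮 𝒦 ν`, Re-UNIFORM by the type: no `ε`, no e-fold budget): from
  every kicked state the UNFORCED flow hands over, within `T₂ ≤ (C_τ/2) / U`, an exact `λ`-zoomed member
  one amplitude level up (`U' ≥ (ηλ)^{1/2} U`, `‖x₀‖ ≤ D`),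

both with finite energy and a sup-ceiling on their slab. This file re-homes the three definitions to the
door's namespace (so that a route file, if the director ever opens shape (α′), IMPORTS them instead of
positing them) and CLOSES the package's support item `StepGluing`, named there as «prover work with tree
tools»:

* `TriggerScheme.stepB_of_pieces` (local form): ONE amplifier run from `w` and ONE valve run from its
  kicked state glue to ONE bounded triggered transfer `StepB ν U ε w` — shift the valve run to start at
  `T₁`, identify it with the amplifier run on the unforced window `[T₁, T₁ + min δ₁ δ₂ / 2]` by Tao's
  UNFORCED unconditional uniqueness (Anal. PDE 2013, Cor. 11.4 — the tree THEOREM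
  `tao_unconditional_uniqueness_velocity_holds`, through `eq_on_unforced_window` of
  `TriggeredTransferJunction.lean`), glue (`IsClassicalNSSolutionOn.glue`, normalised pressures), and
  check the clock `T₁ + T₂ ≤ C_τ (1 + |log ε|)^q / U` (because `(1 + |log ε|)^q ≥ 1`);
* `TriggerScheme.transfersB_of_amplifies_valve` / **`TriggerScheme.stepGluing`**:
  `∀ 𝒮 𝒦 ν, 0 < ν → Amplifies 𝒮 𝒦 ν → Valve 𝒮 𝒦 ν → 𝒮.TransfersB ν` (the package's `StepGluing`,
  literally), and the (C) closers `navierStokesBreakdownR3_of_amplifies_valve` (any `ν > 0`, ZERO named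
  facts, via `navierStokesBreakdownR3_of_exists_transfersB_at`) / `…_of_exists_pieces`;
* the junk map / BC2 probes of the split (monotonicity in the kicked alphabet, the empty alphabet,
  the valve-only «quiet» door) are the companion file `TriggeredTransferAmplifierValveProbes.lean`.

References: T. Tao, J. Amer. Math. Soc. 29 (2016) 601–674, §1.3 [cite: Tao2016AveragedNS, §1.3];
T. Tao, Anal. PDE 6 (2013), Cor. 11.4 [cite: Tao2011, Cor. 11.4]; C. L. Fefferman, Clay problem
description, (C) [cite: FeffermanClay2006, (C)]. 0 sorry; axioms ⊆ {propext, Classical.choice, Quot.sound}.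
-/

noncomputable section

namespace Summit.NavierStokesRegularity.FluidComputer.TriggeredTransfer

open Set MeasureTheory Function
open scoped ENNReal ContDiff NNReal
open Literature.Analysis.FluidPDE
open Literature.Analysis.FluidPDE.FluidComputer (E3 Vel)

namespace TriggerScheme

variable (𝒮 : TriggerScheme)

/-! ## The vocabulary of the split (planner's typing, `Sketch_alpha.lean`) -/

/-- **A kicked alphabet for the scheme `𝒮`** (posited interface of shape (α′)): for each amplitude
`U` a set `K U` of unit-scale «kicked» states (the parent letter plus an O(1) unstable-mode excursion),
Clay data, keeping the parent's speed floor in the nest ball. STATIC axioms only; which states are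
kicked is constrained solely by the two dynamic predicates `Amplifies` / `Valve` (the glue below
consumes only the rapid decay in `clay` — the common slice of the two runs must be an `H¹` datum for
Tao's uniqueness; `floor` is the physical reading «kicked state OF THE LEVEL» and is used by no theorem
of this file). A TYPE; no instance is claimed (the empty alphabet inhabits it trivially — a junk probe of
the companion file). [cite: Tao2016AveragedNS, §1.3] -/
structure KickAlphabet where
  /-- kicked states at amplitude `U` (unit scale) -/
  K : ℝ → Set Vel
  /-- every kicked state is a Clay datum -/
  clay : ∀ U, 𝒮.UStar ≤ U → ∀ v ∈ K U, ContDiff ℝ ∞ v ∧ NSWave0.IsDivFree v ∧ HasRapidSpatialDecay v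
  /-- kicked states keep the speed floor of the level -/
  floor : ∀ U, 𝒮.UStar ≤ U → ∀ v ∈ K U, ∃ x : E3, ‖x‖ ≤ 𝒮.R ∧ 𝒮.c * U ≤ ‖v x‖

/-- **AMPLIFIER at viscosity `ν`** (piece T; the Re-dependent half of a triggered transfer): from
every member `w ∈ F U`, `U ≥ U⋆`, every admissible seed amplitude `ε` (`0 < ε ≤ 1`,
`ν |log ε| ≤ a U`) is amplified — there are a time `T₁ ≤ (C_τ/2) (1 + |log ε|)^q / U`, a margin `δ`
(`0 < δ`, `2δ < T₁`), an admissible trigger `g` of amplitude `ε` switched off from `T₁` on, and an exact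
classical finite-energy solution of the forced system on `[0, T₁ + δ]`, bounded on its slab, from
`u 0 = w`, whose state at `T₁` is KICKED: `u T₁ ∈ K U`. Open; never asserted. [cite: Tao2016AveragedNS, §1.3] -/
def Amplifies (𝒦 : 𝒮.KickAlphabet) (ν : ℝ) : Prop :=
  ∀ U, 𝒮.UStar ≤ U → ∀ w ∈ 𝒮.F U, ∀ ε : ℝ, 0 < ε → ε ≤ 1 → ν * |Real.log ε| ≤ 𝒮.a * U →
    ∃ (T₁ δ : ℝ) (g : ℝ → Vel) (u : ℝ → Vel) (p : ℝ → E3 → ℝ),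
      0 < δ ∧ 2 * δ < T₁ ∧ T₁ ≤ 𝒮.Cτ / 2 * (1 + |Real.log ε|) ^ 𝒮.q / U ∧
      𝒮.IsTrigger ε δ T₁ g ∧
      IsClassicalNSSolutionOn (Icc 0 (T₁ + δ)) ν g u p ∧ u 0 = w ∧
      (∃ C : ℝ≥0∞, C < ⊤ ∧ ∀ t ∈ Icc 0 (T₁ + δ), ∫⁻ x, ‖u t x‖ₑ ^ 2 ≤ C) ∧
      (∃ M : ℝ, ∀ t ∈ Icc 0 (T₁ + δ), ∀ x, ‖u t x‖ ≤ M) ∧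
      u T₁ ∈ 𝒦.K U

/-- **VALVE at viscosity `ν`** (piece V; Re-UNIFORM by the type — no `ε`, no e-fold budget): from
every kicked state `v ∈ K U`, `U ≥ U⋆`, the UNFORCED flow hands over — there are `T₂ ≤ (C_τ/2) / U`,
a margin `δ` (`0 < δ`, `2δ < T₂`), and an exact classical finite-energy solution of the unforced system
on `[0, T₂ + δ]`, bounded on its slab, from `u 0 = v`, with `u T₂ = (x ↦ λ • w' (λ • (x - x₀)))`,
`w' ∈ F U'`, `U' ≥ (ηλ)^{1/2} U`, `‖x₀‖ ≤ D`. Open; never asserted. [cite: Tao2016AveragedNS, §1.3] -/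
def Valve (𝒦 : 𝒮.KickAlphabet) (ν : ℝ) : Prop :=
  ∀ U, 𝒮.UStar ≤ U → ∀ v ∈ 𝒦.K U,
    ∃ (T₂ δ : ℝ) (u : ℝ → Vel) (p : ℝ → E3 → ℝ),
      0 < δ ∧ 2 * δ < T₂ ∧ T₂ ≤ 𝒮.Cτ / 2 / U ∧
      IsClassicalNSSolutionOn (Icc 0 (T₂ + δ)) ν (fun _ => (0 : Vel)) u p ∧ u 0 = v ∧
      (∃ C : ℝ≥0∞, C < ⊤ ∧ ∀ t ∈ Icc 0 (T₂ + δ), ∫⁻ x, ‖u t x‖ₑ ^ 2 ≤ C) ∧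
      (∃ M : ℝ, ∀ t ∈ Icc 0 (T₂ + δ), ∀ x, ‖u t x‖ ≤ M) ∧
      ∃ (U' : ℝ) (w' : Vel) (x₀ : E3), 𝒮.growth * U ≤ U' ∧ w' ∈ 𝒮.F U' ∧ ‖x₀‖ ≤ 𝒮.D ∧
        u T₂ = fun x => 𝒮.lam • w' (𝒮.lam • (x - x₀))

variable {𝒮}

/-! ## Elementary facts about triggers and the clock -/

/-- An admissible trigger for `(δ, T)` is admissible for any shorter initial layer `δ' ≤ δ` and any
later hand-over time `T' ≥ T` (it is off before `δ' ≤ δ` and after `T' ≥ T`). [folklore] -/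
theorem IsTrigger.mono {ε δ δ' T T' : ℝ} {g : ℝ → Vel} (h : 𝒮.IsTrigger ε δ T g) (hδ : δ' ≤ δ)
    (hT : T ≤ T') : 𝒮.IsTrigger ε δ' T' g where
  smooth := h.smooth
  off_early t ht := h.off_early t (ht.trans hδ)
  off_late t ht := h.off_late t (hT.trans ht)
  off_far := h.off_far
  small := h.small

/-- The poly-logarithmic factor of the transfer-time law is at least one. [folklore] -/
theorem one_le_logFactor (ε : ℝ) : 1 ≤ (1 + |Real.log ε|) ^ 𝒮.q :=
  one_le_pow₀ (by linarith [abs_nonneg (Real.log ε)])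

/-- **The clock of the split**: half the budget at the logarithmic law plus half the budget at the
Re-uniform law fits in the door's law, `T₁ + T₂ ≤ C_τ (1 + |log ε|)^q / U` (`U > 0`). [folklore] -/
theorem clock_of_pieces {U ε T₁ T₂ : ℝ} (hU : 0 < U)
    (hT₁ : T₁ ≤ 𝒮.Cτ / 2 * (1 + |Real.log ε|) ^ 𝒮.q / U) (hT₂ : T₂ ≤ 𝒮.Cτ / 2 / U) :
    T₁ + T₂ ≤ 𝒮.Cτ * (1 + |Real.log ε|) ^ 𝒮.q / U := by
  have h2 : 𝒮.Cτ / 2 / U ≤ 𝒮.Cτ / 2 * (1 + |Real.log ε|) ^ 𝒮.q / U :=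
    div_le_div_of_nonneg_right
      (le_mul_of_one_le_right (by linarith [𝒮.Cτ_pos]) (𝒮.one_le_logFactor ε)) hU.le
  calc T₁ + T₂ ≤ 𝒮.Cτ / 2 * (1 + |Real.log ε|) ^ 𝒮.q / U + 𝒮.Cτ / 2 * (1 + |Real.log ε|) ^ 𝒮.q / U :=
        add_le_add hT₁ (hT₂.trans h2)
    _ = 𝒮.Cτ * (1 + |Real.log ε|) ^ 𝒮.q / U := by ring

/-! ## The glue: amplifier run + valve run = one bounded triggered transfer -/

/-- **Local gluing lemma.** Let `ν > 0`, `U > 0`. Suppose an AMPLIFIER RUN from `w` is given — a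
trigger `g` of amplitude `ε` admissible for `(δ₁, T₁)`, `0 < δ₁`, `2δ₁ < T₁`,
`T₁ ≤ (C_τ/2)(1 + |log ε|)^q / U`, an exact classical solution `(u₁, p₁)` forced by `g` on
`[0, T₁ + δ₁]` from `u₁ 0 = w` with finite energy and a sup-ceiling, whose slice `u₁ T₁` is rapidly
decaying — and a VALVE RUN from that slice — `0 < δ₂`, `2δ₂ < T₂`, `T₂ ≤ (C_τ/2)/U`, an exact classical
solution `(u₂, p₂)` of the UNFORCED system on `[0, T₂ + δ₂]` from `u₂ 0 = u₁ T₁` with finite energy and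
a sup-ceiling, handing over `u₂ T₂ = (x ↦ λ • w' (λ • (x - x₀)))`, `w' ∈ F U'`, `U' ≥ growth · U`,
`‖x₀‖ ≤ D`. Then `StepB ν U ε w`: the field equal to `u₁` before `T₁ + min δ₁ δ₂ / 2` and to
`u₂ (· - T₁)` after is ONE bounded triggered transfer with hand-over time `T₁ + T₂` and margin
`min δ₁ δ₂ / 2`. Proof: on the window `[T₁, T₁ + min δ₁ δ₂ / 2]` both are unforced classical
finite-energy solutions from the same rapidly decaying slice, hence equal (`eq_on_unforced_window`,
Tao 2013 Cor. 11.4); glue along the open overlap (`IsClassicalNSSolutionOn.glue`); the trigger is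
admissible for the longer window (`IsTrigger.mono`) and the clock adds up (`clock_of_pieces`).
[cite: Tao2011, Cor. 11.4] -/
theorem stepB_of_pieces {ν U ε : ℝ} {w : Vel} (hν : 0 < ν) (hU : 0 < U)
    {T₁ δ₁ : ℝ} {g u₁ : ℝ → Vel} {p₁ : ℝ → E3 → ℝ}
    (hδ₁ : 0 < δ₁) (h2δ₁ : 2 * δ₁ < T₁) (hT₁ : T₁ ≤ 𝒮.Cτ / 2 * (1 + |Real.log ε|) ^ 𝒮.q / U)
    (htrig : 𝒮.IsTrigger ε δ₁ T₁ g) (hsol₁ : IsClassicalNSSolutionOn (Icc 0 (T₁ + δ₁)) ν g u₁ p₁)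
    (hu₁0 : u₁ 0 = w) (hE₁ : ∃ C : ℝ≥0∞, C < ⊤ ∧ ∀ t ∈ Icc 0 (T₁ + δ₁), ∫⁻ x, ‖u₁ t x‖ₑ ^ 2 ≤ C)
    (hM₁ : ∃ M : ℝ, ∀ t ∈ Icc 0 (T₁ + δ₁), ∀ x, ‖u₁ t x‖ ≤ M)
    (hdec : HasRapidSpatialDecay (u₁ T₁))
    {T₂ δ₂ : ℝ} {u₂ : ℝ → Vel} {p₂ : ℝ → E3 → ℝ}
    (hδ₂ : 0 < δ₂) (h2δ₂ : 2 * δ₂ < T₂) (hT₂ : T₂ ≤ 𝒮.Cτ / 2 / U)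
    (hsol₂ : IsClassicalNSSolutionOn (Icc 0 (T₂ + δ₂)) ν (fun _ => (0 : Vel)) u₂ p₂)
    (hu₂0 : u₂ 0 = u₁ T₁) (hE₂ : ∃ C : ℝ≥0∞, C < ⊤ ∧ ∀ t ∈ Icc 0 (T₂ + δ₂), ∫⁻ x, ‖u₂ t x‖ₑ ^ 2 ≤ C)
    (hM₂ : ∃ M : ℝ, ∀ t ∈ Icc 0 (T₂ + δ₂), ∀ x, ‖u₂ t x‖ ≤ M)
    {U' : ℝ} {w' : Vel} {x₀ : E3} (hgrow : 𝒮.growth * U ≤ U') (hw' : w' ∈ 𝒮.F U')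
    (hx₀ : ‖x₀‖ ≤ 𝒮.D) (hhand : u₂ T₂ = fun x => 𝒮.lam • w' (𝒮.lam • (x - x₀))) :
    𝒮.StepB ν U ε w := by
  -- the margin of the glued piece and the elementary inequalities
  set δ : ℝ := min δ₁ δ₂ / 2 with hδ_def
  have hmin₁ : min δ₁ δ₂ ≤ δ₁ := min_le_left _ _
  have hmin₂ : min δ₁ δ₂ ≤ δ₂ := min_le_right _ _
  have hmin_pos : 0 < min δ₁ δ₂ := lt_min hδ₁ hδ₂
  have hδ_pos : 0 < δ := by rw [hδ_def]; linarith
  have hδ_lt₁ : δ < δ₁ := by rw [hδ_def]; linarith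
  have hδ_lt₂ : δ < δ₂ := by rw [hδ_def]; linarith
  have hT₁_pos : 0 < T₁ := by linarith
  have hT₂_pos : 0 < T₂ := by linarith
  have hδ_lt_T₂ : δ < T₂ := by linarith
  -- the shifted valve run, on `[T₁, T₁ + T₂ + δ₂]`, unforced
  have hshift : IsClassicalNSSolutionOn (Icc T₁ (T₁ + T₂ + δ₂)) ν (fun _ => (0 : Vel))
      (fun t => u₂ (t - T₁)) (fun t => p₂ (t - T₁)) := by
    have h := hsol₂.comp_add_right (-T₁)
    simp only [← sub_eq_add_neg] at h
    exact h.mono (fun t ht => ⟨by linarith [ht.1], by linarith [ht.2]⟩)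
      (uniqueDiffOn_Icc (by linarith))
  -- THE JUNCTION: on the window `[T₁, T₁ + δ]` the two runs agree (Tao 2013, Cor. 11.4, unforced)
  have hwin₁ : IsClassicalNSSolutionOn (Icc T₁ (T₁ + δ)) ν g u₁ p₁ :=
    hsol₁.mono (Icc_subset_Icc hT₁_pos.le (by linarith)) (uniqueDiffOn_Icc (by linarith))
  have hwin₂ : IsClassicalNSSolutionOn (Icc T₁ (T₁ + δ)) ν (fun _ => (0 : Vel))
      (fun t => u₂ (t - T₁)) (fun t => p₂ (t - T₁)) :=
    hshift.mono (Icc_subset_Icc le_rfl (by linarith)) (uniqueDiffOn_Icc (by linarith))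
  have hEw₁ : ∃ C : ℝ≥0∞, C < ⊤ ∧ ∀ t ∈ Icc T₁ (T₁ + δ), ∫⁻ x, ‖u₁ t x‖ₑ ^ 2 ≤ C := by
    obtain ⟨C, hC, hb⟩ := hE₁
    exact ⟨C, hC, fun t ht => hb t ⟨by linarith [ht.1], by linarith [ht.2]⟩⟩
  have hEw₂ : ∃ C : ℝ≥0∞, C < ⊤ ∧ ∀ t ∈ Icc T₁ (T₁ + δ), ∫⁻ x, ‖u₂ (t - T₁) x‖ₑ ^ 2 ≤ C := by
    obtain ⟨C, hC, hb⟩ := hE₂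
    exact ⟨C, hC, fun t ht => hb (t - T₁) ⟨by linarith [ht.1], by linarith [ht.2]⟩⟩
  have heq : ∀ t ∈ Icc T₁ (T₁ + δ), u₁ t = u₂ (t - T₁) :=
    eq_on_unforced_window hν (by linarith) hwin₁ hwin₂
      (fun t ht => htrig.off_late t ht.1) (fun _ _ => rfl)
      (by simp only [sub_self, hu₂0]) hdec hEw₁ hEw₂
  -- THE GLUING along the open overlap `(T₁, T₁ + δ)`
  have hg₁ : IsClassicalNSSolutionOn (Ico 0 (T₁ + δ)) ν g u₁ p₁ :=
    hsol₁.mono (fun t ht => ⟨ht.1, by linarith [ht.2]⟩) (uniqueDiffOn_Ico 0 _)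
  have hg₂ : IsClassicalNSSolutionOn (Ioo T₁ (T₁ + T₂ + δ₂)) ν g (fun t => u₂ (t - T₁))
      (fun t => p₂ (t - T₁)) :=
    (hshift.mono Ioo_subset_Icc_self isOpen_Ioo.uniqueDiffOn).force_congr
      fun t ht => (htrig.off_late t ht.1.le).symm
  have hglue := hg₁.glue hg₂ hT₁_pos.le (by linarith) (by linarith)
    (fun t ht => heq t ⟨ht.1.le, ht.2.le⟩)
  have hsol : IsClassicalNSSolutionOn (Icc 0 (T₁ + T₂ + δ)) ν g
      (fun t => if t < T₁ + δ then u₁ t else u₂ (t - T₁))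
      (fun t => if t < T₁ + δ then (fun x => p₁ t x - p₁ t 0)
        else fun x => p₂ (t - T₁) x - p₂ (t - T₁) 0) :=
    hglue.mono (fun t ht => ⟨ht.1, by linarith [ht.2]⟩) (uniqueDiffOn_Icc (by linarith))
  -- the ceilings and energies of the glued piece
  obtain ⟨C₁, hC₁, hb₁⟩ := hE₁
  obtain ⟨C₂, hC₂, hb₂⟩ := hE₂
  obtain ⟨M₁, hm₁⟩ := hM₁
  obtain ⟨M₂, hm₂⟩ := hM₂
  -- the link
  refine ⟨{ T := T₁ + T₂
            δ := δ
            g := g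
            u := fun t => if t < T₁ + δ then u₁ t else u₂ (t - T₁)
            p := fun t => if t < T₁ + δ then (fun x => p₁ t x - p₁ t 0)
              else fun x => p₂ (t - T₁) x - p₂ (t - T₁) 0
            U' := U'
            w' := w'
            x₀ := x₀
            δ_pos := hδ_pos
            two_δ_lt := by rw [hδ_def]; linarith
            T_le := 𝒮.clock_of_pieces hU hT₁ hT₂
            trigger := htrig.mono hδ_lt₁.le (by linarith)
            classical := by simpa only [add_assoc] using hsol
            initial := by
              show (if (0 : ℝ) < T₁ + δ then u₁ 0 else u₂ (0 - T₁)) = w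
              rw [if_pos (by linarith), hu₁0]
            energy := ?_
            growth_le := hgrow
            mem := hw'
            norm_x₀_le := hx₀
            handover := by
              show (if T₁ + T₂ < T₁ + δ then u₁ (T₁ + T₂) else u₂ (T₁ + T₂ - T₁)) = _
              rw [if_neg (by linarith), show T₁ + T₂ - T₁ = T₂ by ring, hhand] }, max M₁ M₂, ?_⟩
  · -- energy of the glued piece
    refine ⟨max C₁ C₂, max_lt hC₁ hC₂, fun t ht => ?_⟩
    by_cases hlt : t < T₁ + δ
    · simp only [if_pos hlt]
      exact (hb₁ t ⟨ht.1, by linarith⟩).trans (le_max_left _ _)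
    · simp only [if_neg hlt]
      have ht' : t - T₁ ∈ Icc 0 (T₂ + δ₂) := ⟨by linarith [not_lt.1 hlt], by linarith [ht.2]⟩
      exact (hb₂ (t - T₁) ht').trans (le_max_right _ _)
  · -- sup-ceiling of the glued piece
    intro t ht x
    simp only at ht ⊢
    by_cases hlt : t < T₁ + δ
    · rw [if_pos hlt]
      exact (hm₁ t ⟨ht.1, by linarith⟩ x).trans (le_max_left _ _)
    · rw [if_neg hlt]
      have ht' : t - T₁ ∈ Icc 0 (T₂ + δ₂) := ⟨by linarith [not_lt.1 hlt], by linarith [ht.2]⟩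
      exact (hm₂ (t - T₁) ht' x).trans (le_max_right _ _)

/-- **`StepGluing`, pointwise form: a scheme with an amplifier AND a valve on a common kicked alphabet
transfers with ceilings** (`ν > 0`). From a member `w ∈ F U` and an admissible seed the amplifier
gives a run to a kicked state; the kicked state is a rapidly decaying Clay datum (`KickAlphabet.clay`),
from which the valve gives an unforced hand-over run; `stepB_of_pieces` glues them.
[cite: Tao2016AveragedNS, §1.3] -/
theorem transfersB_of_amplifies_valve {𝒦 : 𝒮.KickAlphabet} {ν : ℝ} (hν : 0 < ν)
    (hA : 𝒮.Amplifies 𝒦 ν) (hV : 𝒮.Valve 𝒦 ν) : 𝒮.TransfersB ν := by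
  intro U hU w hw ε hε hε1 hadm
  obtain ⟨T₁, δ₁, g, u₁, p₁, hδ₁, h2δ₁, hT₁, htrig, hsol₁, hu₁0, hE₁, hM₁, hkick⟩ :=
    hA U hU w hw ε hε hε1 hadm
  obtain ⟨T₂, δ₂, u₂, p₂, hδ₂, h2δ₂, hT₂, hsol₂, hu₂0, hE₂, hM₂, U', w', x₀, hgrow, hw', hx₀, hhand⟩ :=
    hV U hU _ hkick
  exact 𝒮.stepB_of_pieces hν (𝒮.UStar_pos.trans_le hU) hδ₁ h2δ₁ hT₁ htrig hsol₁ hu₁0 hE₁ hM₁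
    (𝒦.clay U hU _ hkick).2.2 hδ₂ h2δ₂ hT₂ hsol₂ hu₂0 hE₂ hM₂ hgrow hw' hx₀ hhand

/-- **`StepGluing`** — the support item of package (α′) (`Sketch_alpha.lean`), literally:
`∀ 𝒮 𝒦 ν, 0 < ν → Amplifies 𝒮 𝒦 ν → Valve 𝒮 𝒦 ν → 𝒮.TransfersB ν`. [cite: Tao2016AveragedNS, §1.3] -/
theorem stepGluing : ∀ (𝒮 : TriggerScheme) (𝒦 : 𝒮.KickAlphabet) (ν : ℝ), 0 < ν →
    𝒮.Amplifies 𝒦 ν → 𝒮.Valve 𝒦 ν → 𝒮.TransfersB ν :=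
  fun _ _ _ hν hA hV => transfersB_of_amplifies_valve hν hA hV

/-- Forgetting the ceilings: amplifier + valve give the door's original predicate `Transfers ν`.
[cite: Tao2016AveragedNS, §1.3] -/
theorem transfers_of_amplifies_valve {𝒦 : 𝒮.KickAlphabet} {ν : ℝ} (hν : 0 < ν)
    (hA : 𝒮.Amplifies 𝒦 ν) (hV : 𝒮.Valve 𝒦 ν) : 𝒮.Transfers ν :=
  (transfersB_of_amplifies_valve hν hA hV).transfers

/-! ## The closers: amplifier + valve on a common design give Clay (C), zero named facts -/

/-- **(C) from the two pieces at any viscosity `ν > 0`**: a scheme with an amplifier and a valve on a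
common kicked alphabet yields `NavierStokesBreakdownR3` — through `TransfersB ν` (`stepGluing`) and the
bounded door's viscosity-free closer `navierStokesBreakdownR3_of_exists_transfersB_at`; NO named fact.
[cite: FeffermanClay2006, (C)] -/
theorem navierStokesBreakdownR3_of_amplifies_valve {𝒦 : 𝒮.KickAlphabet} {ν : ℝ} (hν : 0 < ν)
    (hA : 𝒮.Amplifies 𝒦 ν) (hV : 𝒮.Valve 𝒦 ν) :
    Summit.NavierStokesRegularity.NavierStokesRegularity.NavierStokesBreakdownR3 :=
  navierStokesBreakdownR3_of_exists_transfersB_at hν ⟨𝒮, transfersB_of_amplifies_valve hν hA hV⟩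

/-- **The package's composition target** (`breakdown_of_pieces` of `Sketch_alpha.lean`, with its
support discharged): SOME design — a scheme with a kicked alphabet — having an amplifier AND a valve at
a viscosity `ν > 0` gives (C). [cite: FeffermanClay2006, (C)] -/
theorem navierStokesBreakdownR3_of_exists_pieces {ν : ℝ} (hν : 0 < ν)
    (h : ∃ (𝒮 : TriggerScheme) (𝒦 : 𝒮.KickAlphabet), 𝒮.Amplifies 𝒦 ν ∧ 𝒮.Valve 𝒦 ν) :
    Summit.NavierStokesRegularity.NavierStokesRegularity.NavierStokesBreakdownR3 := by
  obtain ⟨𝒮, 𝒦, hA, hV⟩ := h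
  exact 𝒮.navierStokesBreakdownR3_of_amplifies_valve hν hA hV

/-- The unit-viscosity spelling (the package's `PiecesAtOne → (C)`). [cite: FeffermanClay2006, (C)] -/
theorem navierStokesBreakdownR3_of_exists_pieces_one
    (h : ∃ (𝒮 : TriggerScheme) (𝒦 : 𝒮.KickAlphabet), 𝒮.Amplifies 𝒦 1 ∧ 𝒮.Valve 𝒦 1) :
    Summit.NavierStokesRegularity.NavierStokesRegularity.NavierStokesBreakdownR3 :=
  navierStokesBreakdownR3_of_exists_pieces one_pos h

end TriggerScheme

end Summit.NavierStokesRegularity.FluidComputer.TriggeredTransfer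

end
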